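import Summits.ResolutionOfSingularities.ResolutionOfSingularities.Theorems.EquisingularLiftEquisingularLiftNatNosePointsFirstHSUB
import Summits.ResolutionOfSingularities.ResolutionOfSingularities.Theorems.EquisingularLiftEquisingularLiftNatResidueHypDefs6
import Summits.ResolutionOfSingularities.ResolutionOfSingularities.Theorems.EquisingularLiftEquisingularLiftNatHostedEngineInit
import HarnessLib

/-!
# [OURS · L1 W4.5(b) · EL♮(3) · NOSE, WIDTH TABLE D4 row D4-4] THE HSUBʰ SUPPLIER OF THE HOSTED-NOSE RUNG (R-ν3) — `hsub_reachHostedNoseBTriplePrime_of_fact`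

res-L1-w45b-nose-w2 g2 (WIDTH seat, nose row; desk WIDTH TABLE D4 2026-08-28T18:46Z «D4-4 nose-w2 = HSUB `hsub_…_of_fact` over K5ʰ + rung (R-ν3) = (R-ν2)'s proof
re-run»; R43 (4) order «HT2 ✓ → stub-2 `hround_of_fact` → nose-w2 HSUBʰ → stub-2 RUNG (R-ν3) → lead-2 texts»). OURS; NOT a statement of any manuscript ([Hironaka2017] is a
candidate under adjudication, nothing of it is asserted); AI-written, weaker than expert review. No `sorry`; standard axioms; DEF-FREE; `--kind proof --supports
stmt-ResolutionOfSingularities-20148 --as helper`. Resolution of singularities in positive characteristic is NOT proved here or anywhere in this chain; EL♮(3) is NOT proved.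

WHAT. res-L1-w45b-stub-2's K5ʰ engine `target_elnat_of_hostedSubchainResolution` (✓ p660091, `…NatHostedSubchainPointResolution`, v2.1 = shape of record) has four supplier
seams HINIT / HPT / HROUND / HSUBʰ. This file is the HSUBʰ seam at `n = 3` and `ReachH := ReachHostedNoseBTriplePrime` (res-type-027 ✓ p661159 `…NatResidueHypDefs6`:
the STAGE-LEVEL nose move, two disjuncts — FREE `DirStepUnobs F₁ univ _ Z hZ` / HOSTED `Z ⊆ closure E₁ ∧ (closure E₁)~ regular along Z̃ ∧ DirStepUnobs F₁ (closure E₁) _ Z hZ` —,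
then `Bl_Z` and a B‴ chain, the host dropped afterwards `E₉ = ∅`), CLOSED OVER the registered NEED-FACT (T-k) in its per-base form `EmbeddedCurveLift O k θ P q`:
from an upstairs stage `(X', σ', S')` with model square `j : F₁ ⟶ X'` and a host model `TCPlus.LetterDatum … E₁` (ideal sheaf `𝓛`, reduced trace `𝓛·𝒪_{F₁} = 𝓘⟨closure E₁⟩`,
`V(𝓛)` regular and `O`-flat), every `ReachHostedNoseBTriplePrime F₁ T₁ E₁ F₉ β T₉ E₉` is matched by a new `Ch`-stage with model square AND the (trivial) host model of
`E₉ = ∅` (stub-2 ✓ `TCPlus.letterDatum_empty`). MECHANISM = (N4) ✓ p649021 (`hsub_reachPtNoseBTriplePrime_of_fact`, res-L1-w45b-nose-w2 g0) re-run at stage level: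
the centre `C ⊆ X'` is ONE application of (T-k) — at `𝓔 = ⊥` in the FREE disjunct (as (N4)), at `𝓔 = 𝓛` = the host's model in the HOSTED disjunct (the letter datum supplies
exactly (T-k)'s inputs: trace, regularity, flatness; properness from the chain) —, E1-legality upstairs by res-L1-w45b-stub-4's `image_support_subset_not_isGenericPoint_of_chain`,
the upstairs blow-up and the model square of `Bl_Z` by `exists_isBlowup` + `modelStep_chain`, the B‴ tail by stub-4's stage-generic nose engine‴
`hsub_reachNoseTowerBTriplePrime_of_fact'` (✓ p647499). Consumed by stub-2's rung (R-ν3) `…NatNoseHostedRung` BY NAME (binder order = the seam's, with `hFact` after `q` as in (N4)).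
-/

set_option linter.dupNamespace false -- mandated namespace `Summit.<Summit>.<Problem>` of this single-conjunct summit
set_option linter.overlappingInstances false -- signatures carry `[IsDomain O] [IsDiscreteValuationRing O]`

noncomputable section

open CategoryTheory CategoryTheory.Limits AlgebraicGeometry TopologicalSpace Topology IsLocalRing
open Literature.AlgebraicGeometry.Resolution
open AlgebraicGeometry.Scheme.IdealSheafData
open Summit.ResolutionOfSingularities.ResolutionOfSingularities.Theses.EquisingularLift.Split
open Summit.ResolutionOfSingularities.ResolutionOfSingularities.Cruxes.EquisingularLift.StrataSplit

namespace Summit.ResolutionOfSingularities.ResolutionOfSingularities.Cruxes.EquisingularLiftNat.Sections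

/-- **THE HSUBʰ SUPPLIER of the hosted-nose rung (R-ν3)** — K5ʰ's `ReachH` seam at `n = 3`, `ReachH := ReachHostedNoseBTriplePrime`, from (T-k) `EmbeddedCurveLift O k θ P q`:
at an upstairs stage `(X', σ', S')` with model square `j : F₁ ⟶ X'` and a host model `TCPlus.LetterDatum O P q Y F₁ X' σ' j E₁`, the data of `ReachHostedNoseBTriplePrime F₁ T₁ E₁ F₉ β T₉ E₉`
give the centre `C ⊆ X'` by (T-k) at `𝓔 = ⊥` (FREE disjunct) or at the host's model `𝓛` (HOSTED disjunct), its blow-up and model by `modelStep_chain`, E1-legality upstairs by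
`image_support_subset_not_isGenericPoint_of_chain`, the B‴ tail by the stage-generic nose engine‴ (✓ p647499), and the host model of `E₉ = ∅` by `TCPlus.letterDatum_empty`.
[folklore glue over the named tree theorems; no new mathematics] [OURS · L1 W4.5b · nose (R-ν3), D4-4] -/
theorem hsub_reachHostedNoseBTriplePrime_of_fact (k : Type) [Field k]
    (O : Type) [CommRing O] [IsDomain O] [IsDiscreteValuationRing O] [IsAdicComplete (IsLocalRing.maximalIdeal O) O]
    [IsAlgClosed (IsLocalRing.ResidueField O)] (θ : O →+* k) (hθ : Function.Surjective θ)
    (P : Scheme.{0}) (q : P ⟶ Spec (.of O))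
    -- (T-k)
    (hFact : EmbeddedCurveLift O k θ P q)
    (Y : Set P) (Ch : ∀ X' : Scheme.{0}, (X' ⟶ P) → Set X' → Prop)
    (hChStep : ∀ (X' X'' : Scheme.{0}) (σ' : X' ⟶ P) (S' : Set X') (C : X'.IdealSheafData) (τ : X'' ⟶ X'),
      Ch X' σ' S' → IsBlowup τ C → Scheme.IsRegular C.subscheme → Flat (C.subschemeι ≫ σ' ≫ q) →
      σ' '' (C.support : Set X') ⊆ {y | ¬ IsGenericPoint y Y} →
      (C.support : Set X') ∩ (σ' ≫ q) ⁻¹' {IsLocalRing.closedPoint O} ⊆ S' →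
      Ch X'' (τ ≫ σ') (closure (τ ⁻¹' (S' \ (C.support : Set X')))))
    (hChSplit : ∀ (X' : Scheme.{0}) (σ' : X' ⟶ P) (S' : Set X'), Ch X' σ' S' → Chain P Y X' σ' S')
    (hYsp : Y ⊆ q ⁻¹' {IsLocalRing.closedPoint O}) (hYirr : IsIrreducible Y) (hYcl : IsClosed Y) (hPint : IsIntegral P)
    (hPnoeth : IsLocallyNoetherian P) (hPreg : Scheme.IsRegular P) (hqprop : IsProper q) (hqsm : SmoothOfRelativeDimension 3 q)
    -- the stage and its model
    (X' : Scheme.{0}) (σ' : X' ⟶ P) (S' : Set X') (hCh' : Ch X' σ' S') (hX'int : IsIntegral X') (hX'noeth : IsLocallyNoetherian X')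
    (hX'reg : Scheme.IsRegular X') (hX'dom : IsDominant (σ' ≫ q))
    (F₁ : Scheme.{0}) (hF₁ : IsIntegral F₁) (j : F₁ ⟶ X') (t : F₁ ⟶ Spec (.of k))
    (hsq : IsPullback j t (σ' ≫ q) (Spec.map (CommRingCat.ofHom θ)))
    (T₁ : Set F₁) (hT₁cl : IsClosed T₁) (hT₁irr : IsIrreducible T₁) (hjT₁ : j '' T₁ = S')
    -- the host and its model
    (E₁ : Set F₁) (hE₁ : TCPlus.LetterDatum O P q Y F₁ X' σ' j E₁)
    -- the hosted nose move
    (F₉ : Scheme.{0}) (β : F₉ ⟶ F₁) (T₉ E₉ : Set F₉) (hReach : ReachHostedNoseBTriplePrime F₁ T₁ E₁ F₉ β T₉ E₉) :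
    ∃ (X₉ : Scheme.{0}) (σ₉ : X₉ ⟶ P) (S₉ : Set X₉) (j₉ : F₉ ⟶ X₉) (t₉ : F₉ ⟶ Spec (.of k)),
      Ch X₉ σ₉ S₉ ∧ IsIntegral X₉ ∧ IsLocallyNoetherian X₉ ∧ Scheme.IsRegular X₉ ∧ IsDominant (σ₉ ≫ q) ∧
      IsPullback j₉ t₉ (σ₉ ≫ q) (Spec.map (CommRingCat.ofHom θ)) ∧ j₉ '' T₉ = S₉ ∧ IsClosed T₉ ∧ IsIrreducible T₉ ∧ IsIntegral F₉ ∧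
      TCPlus.LetterDatum O P q Y F₉ X₉ σ₉ j₉ E₉ := by
  classical
  obtain ⟨hE₉, Z, hZ, hZT, hTZ, hZinf, hZdim, hZreg, hGreg, hunobs, F₃, υ', hυ', γ', E', Es', Ns', K', htower, hβ⟩ := hReach
  subst hE₉
  subst hjT₁
  haveI := hPint; haveI := hPnoeth; haveI := hX'int; haveI := hX'noeth; haveI := hF₁
  -- properness of the stage over `O`, flatness of the integral dominant stage
  obtain ⟨-, -, hσ'prop⟩ := chain_isRegular P Y X' σ' (j '' T₁) (hChSplit _ _ _ hCh') hPnoeth hPreg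
  haveI := hσ'prop
  haveI : IsProper q := hqprop
  haveI : IsDominant (σ' ≫ q) := hX'dom
  have hflat : Flat (σ' ≫ q) := flat_of_isIntegral_of_isDominant (σ' ≫ q)
  haveI := hflat
  -- THE CENTRE from (T-k): at `𝓔 = ⊥` (free nose) or at the host's model `𝓛` (hosted nose)
  obtain ⟨C, hCreg, hCfl, hCj⟩ : ∃ C : X'.IdealSheafData, Scheme.IsRegular C.subscheme ∧ Flat (C.subschemeι ≫ σ' ≫ q) ∧
      C.comap j = vanishingIdeal (⟨Z, hZ⟩ : Closeds F₁) := by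
    rcases hunobs with hfree | ⟨hZE, hEreg, hunobsE⟩
    · -- FREE: (T-k) at `⊥` — `V(⊥) = X'` regular, flat, proper; trace `(⊥).comap j = 𝓘⟨univ⟩` on the integral `F₁` ((N4) verbatim)
      have hbotreg : Scheme.IsRegular (⊥ : X'.IdealSheafData).subscheme := by
        intro y
        haveI := hX'reg ((⊥ : X'.IdealSheafData).subschemeι y)
        exact IsRegularLocalRing.of_ringEquiv (asIso ((⊥ : X'.IdealSheafData).subschemeι.stalkMap y)).commRingCatIsoToRingEquiv
      have hbotflat : Flat ((⊥ : X'.IdealSheafData).subschemeι ≫ σ' ≫ q) := inferInstance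
      have hbotprop : IsProper ((⊥ : X'.IdealSheafData).subschemeι ≫ σ' ≫ q) := inferInstance
      obtain ⟨C, -, hCreg, hCfl, hCj, -⟩ := hFact X' σ' ⊥ hX'int hX'noeth hX'reg hbotreg hbotflat hbotprop F₁ j t hsq
        Set.univ isClosed_univ
        (by rw [Scheme.IdealSheafData.comap_bot, show (⟨Set.univ, isClosed_univ⟩ : Closeds F₁) = ⊤ from rfl, vanishingIdeal_top,
          Scheme.nilradical_eq_bot])
        Z hZ (Set.subset_univ Z) hZreg hGreg hfree
      exact ⟨C, hCreg, hCfl, hCj⟩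
    · -- HOSTED: (T-k) at the host's model `𝓛` (reduced trace `𝓘⟨closure E₁⟩`, regular, flat; proper through the chain)
      obtain ⟨𝓛, hLj, -, hLreg, -, hLflat⟩ := hE₁
      have hLprop : IsProper (𝓛.subschemeι ≫ σ' ≫ q) := inferInstance
      obtain ⟨C, -, hCreg, hCfl, hCj, -⟩ := hFact X' σ' 𝓛 hX'int hX'noeth hX'reg hLreg hLflat hLprop F₁ j t hsq
        (closure E₁) isClosed_closure hLj Z hZ hZE hZreg hEreg hunobsE
      exact ⟨C, hCreg, hCfl, hCj⟩
  -- E1-legality of `C` upstairs: off the generic point of `Y`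
  have hoff : σ' '' (C.support : Set X') ⊆ {y : P | ¬ IsGenericPoint y Y} :=
    image_support_subset_not_isGenericPoint_of_chain θ hθ q Y hYsp σ' (j '' T₁) (hChSplit _ _ _ hCh') j t hsq T₁ rfl C Z hZ hCj hTZ
  have hCoff : ∀ c ∈ (C.support : Set X'), ¬ IsGenericPoint (σ' c) Y := fun c hc => hoff ⟨c, hc, rfl⟩
  -- the upstairs blow-up of `C` and the model square for the nose blow-up `υ'` (`modelStep_chain`)
  have hDT : (((vanishingIdeal (⟨Z, hZ⟩ : Closeds F₁)) : F₁.IdealSheafData).support : Set F₁) ⊆ T₁ := by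
    rw [Scheme.IdealSheafData.coe_support_vanishingIdeal]; exact hZT
  have hTD : ¬ T₁ ⊆ (((vanishingIdeal (⟨Z, hZ⟩ : Closeds F₁)) : F₁.IdealSheafData).support : Set F₁) := by
    rw [Scheme.IdealSheafData.coe_support_vanishingIdeal]; exact hTZ
  obtain ⟨X₂, τ₂, hτ₂⟩ := exists_isBlowup X' C
  obtain ⟨hX₂i, hX₂n, hX₂r, hX₂dom, hF₃i, hirr₃, j₃, t₃, hsq₃, hcomm₃, hCh₃⟩ :=
    modelStep_chain O k θ hθ P q Y hYirr hYcl Ch hChSplit hChStep X' σ' (j '' T₁) hCh' hX'reg hX'dom F₁ j t hsq T₁ rfl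
      C (vanishingIdeal (⟨Z, hZ⟩ : Closeds F₁)) hCj hCreg hCfl hoff hDT hTD X₂ τ₂ hτ₂ F₃ υ' hυ'
  rw [Scheme.IdealSheafData.coe_support_vanishingIdeal] at hirr₃ hCh₃
  have hexc₃ : (C.comap τ₂).comap j₃ = (vanishingIdeal (⟨Z, hZ⟩ : Closeds F₁)).comap υ' := by
    rw [← Scheme.IdealSheafData.comap_comp, hcomm₃, Scheme.IdealSheafData.comap_comp, hCj]
  -- the stage-generic nose engine‴ on the B‴ tail
  obtain ⟨X₉, σ₉, S₉, j₉, t₉, h1, h2, h3, h4, h5, h6, h7, h8, h9, h10⟩ :=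
    hsub_reachNoseTowerBTriplePrime_of_fact' k O θ hθ P q Y Ch hChStep hChSplit hYsp hYirr hYcl hPint hPnoeth hPreg hqprop hqsm
      X' σ' (j '' T₁) hCh' hX'int hX'noeth hX'reg hX'dom F₁ hF₁ j t hsq T₁ hT₁cl hT₁irr rfl
      Z hZ hZT hTZ hZinf hZdim C hCreg hCfl hCj hCoff X₂ τ₂ hτ₂ hX₂i hX₂n hX₂r hX₂dom F₃ hF₃i υ' hυ' j₃ t₃ hsq₃ hcomm₃ hexc₃ hirr₃ hCh₃ hFact
      F₉ γ' T₉ E' K' ⟨Es', Ns', htower⟩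
  -- the host is dropped: `E₉ = ∅` has the trivial model
  exact ⟨X₉, σ₉, S₉, j₉, t₉, h1, h2, h3, h4, h5, h6, h7, h8, h9, h10, TCPlus.letterDatum_empty O P q Y F₉ X₉ σ₉ j₉⟩


/-- **THE HSUBʰ SEAM OF K5ʰ AT `n = 3`, `ReachH := ReachHostedNoseBTriplePrime`, DISCHARGED MODULO (T-k).** The hypothesis text is res-L1-w45b-stub-2's
`target_elnat_of_hostedSubchainResolution` HSUBʰ binder (✓ p660091, source l.112–127) VERBATIM with `n ↦ 3` and `ReachH ↦ ReachHostedNoseBTriplePrime`; the proof is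
`hsub_reachHostedNoseBTriplePrime_of_fact` fed with `EmbeddedCurveLiftFact` at the base `(k, O, θ, P, q)`. The rung (R-ν3) passes this term to K5ʰ by name.
[OURS · L1 W4.5b · nose (R-ν3), D4-4; pure composition] -/
theorem hsubh_reachHostedNoseBTriplePrime_of_embeddedCurveLiftFact (hF : EmbeddedCurveLiftFact) (k : Type) [Field k] [IsAlgClosed k] :
    ∀ (O : Type) [CommRing O] [IsDomain O] [IsDiscreteValuationRing O] [IsAdicComplete (IsLocalRing.maximalIdeal O) O] [IsAlgClosed (IsLocalRing.ResidueField O)] (θ : O →+* k), Function.Surjective θ →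
      ∀ (P : AlgebraicGeometry.Scheme.{0}) (q : P ⟶ AlgebraicGeometry.Spec (.of O)) (Y : Set P) (Ch : ∀ X' : AlgebraicGeometry.Scheme.{0}, (X' ⟶ P) → Set X' → Prop),
        (∀ (X' X'' : AlgebraicGeometry.Scheme.{0}) (σ' : X' ⟶ P) (S' : Set X') (C : X'.IdealSheafData) (τ : X'' ⟶ X'), Ch X' σ' S' → Literature.AlgebraicGeometry.Resolution.IsBlowup τ C →
          Literature.AlgebraicGeometry.Resolution.Scheme.IsRegular C.subscheme → AlgebraicGeometry.Flat (C.subschemeι ≫ σ' ≫ q) → σ' '' (C.support : Set X') ⊆ {y | ¬ IsGenericPoint y Y} →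
          (C.support : Set X') ∩ (σ' ≫ q) ⁻¹' {IsLocalRing.closedPoint O} ⊆ S' → Ch X'' (τ ≫ σ') (closure (τ ⁻¹' (S' \ (C.support : Set X'))))) → (∀ (X' : AlgebraicGeometry.Scheme.{0}) (σ' : X' ⟶ P) (S' : Set X'), Ch X' σ' S' →
          Summit.ResolutionOfSingularities.ResolutionOfSingularities.Theses.EquisingularLift.Split.Chain P Y X' σ' S') → Y ⊆ q ⁻¹' {IsLocalRing.closedPoint O} → IsIrreducible Y → IsClosed Y →
        AlgebraicGeometry.IsIntegral P → IsLocallyNoetherian P → Literature.AlgebraicGeometry.Resolution.Scheme.IsRegular P → AlgebraicGeometry.IsProper q → AlgebraicGeometry.SmoothOfRelativeDimension 3 q →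
      ∀ (X' : AlgebraicGeometry.Scheme.{0}) (σ' : X' ⟶ P) (S' : Set X'), Ch X' σ' S' → AlgebraicGeometry.IsIntegral X' → IsLocallyNoetherian X' → Literature.AlgebraicGeometry.Resolution.Scheme.IsRegular X' →
        AlgebraicGeometry.IsDominant (σ' ≫ q) →
      ∀ (F₁ : AlgebraicGeometry.Scheme.{0}), AlgebraicGeometry.IsIntegral F₁ → ∀ (j : F₁ ⟶ X') (t : F₁ ⟶ AlgebraicGeometry.Spec (.of k)), IsPullback j t (σ' ≫ q) (AlgebraicGeometry.Spec.map (CommRingCat.ofHom θ)) →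
      ∀ (T₁ : Set F₁), IsClosed T₁ → IsIrreducible T₁ → j '' T₁ = S' →
      ∀ (E₁ : Set F₁), TCPlus.LetterDatum O P q Y F₁ X' σ' j E₁ →
      ∀ (F₉ : AlgebraicGeometry.Scheme.{0}) (β : F₉ ⟶ F₁) (T₉ E₉ : Set F₉), ReachHostedNoseBTriplePrime F₁ T₁ E₁ F₉ β T₉ E₉ → ∃ (X₉ : AlgebraicGeometry.Scheme.{0}) (σ₉ : X₉ ⟶ P) (S₉ : Set X₉) (j₉ : F₉ ⟶ X₉) (t₉ : F₉ ⟶ AlgebraicGeometry.Spec (.of k)),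
          Ch X₉ σ₉ S₉ ∧ AlgebraicGeometry.IsIntegral X₉ ∧ IsLocallyNoetherian X₉ ∧ Literature.AlgebraicGeometry.Resolution.Scheme.IsRegular X₉ ∧ AlgebraicGeometry.IsDominant (σ₉ ≫ q) ∧
          IsPullback j₉ t₉ (σ₉ ≫ q) (AlgebraicGeometry.Spec.map (CommRingCat.ofHom θ)) ∧ j₉ '' T₉ = S₉ ∧ IsClosed T₉ ∧ IsIrreducible T₉ ∧ AlgebraicGeometry.IsIntegral F₉ ∧ TCPlus.LetterDatum O P q Y F₉ X₉ σ₉ j₉ E₉ := by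
  intro O _ _ _ _ _ θ hθ P q Y Ch hChStep hChSplit hYsp hYirr hYcl hPint hPnoeth hPreg hqprop hqsm X' σ' S' hCh' hX'int hX'noeth hX'reg hX'dom
    F₁ hF₁ j t hsq T₁ hT₁cl hT₁irr hjT₁ E₁ hE₁ F₉ β T₉ E₉ hReach
  exact hsub_reachHostedNoseBTriplePrime_of_fact k O θ hθ P q (hF k O θ hθ P q) Y Ch hChStep hChSplit hYsp hYirr hYcl hPint hPnoeth hPreg hqprop hqsm
    X' σ' S' hCh' hX'int hX'noeth hX'reg hX'dom F₁ hF₁ j t hsq T₁ hT₁cl hT₁irr hjT₁ E₁ hE₁ F₉ β T₉ E₉ hReach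

end Summit.ResolutionOfSingularities.ResolutionOfSingularities.Cruxes.EquisingularLiftNat.Sections

end
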